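import Literature.NumberTheory.NumberFields.CubicField14483Ideals
import HarnessLib

/-!
# The cubic field of discriminant `-14483`, V: the remaining class-group witnesses
# (`𝔭₁₉, 𝔭₂₃, 𝔭₂₉, 𝔭₂₀₆₉, 𝔮₂₀₆₉, 𝔮₇` and `𝔭₂⁸ = (6 + γ - δ)`)

Continuation of `CubicField14483Ideals.lean` (norm form, `2`-adic residue maps, the certificate
`span_eq_mul_pow_p2_of`, witnesses for the primes above `3, 5, 7`). Same format: each identity `(x) = 𝔭 · 𝔭₂ᵏ` is
certified by two congruences and one norm; `(-1 - γ) = 𝔮₇` and `(6 + γ - δ) = 𝔭₂⁸` by one congruence and one norm.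
Everything is proved; theorems only. [cite: Marcus2018, Ch. 5, Thm. 35]

## References
* [Marcus2018] D. A. Marcus, *Number Fields*, 2nd ed. (2018), Ch. 3 Thm. 22, Thm. 27; Ch. 5 Thm. 35.
-/

noncomputable section

open Polynomial Module NumberField Ideal
open scoped NumberField

namespace Literature.NumberTheory.NumberFields

namespace CubicField14483

open MonicCubic

variable {K : Type*} [Field K] [NumberField K] {γ : K}

/-- **`(-4 + -1γ + 0δ) = 𝔭 · 𝔭₂^3`** with `𝔭 = ker φ`, `φ : 𝓞 K → ℤ/19`, `(φ(γ), φ(δ)) = (15, 0)`; certificate: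
`ψ(x) = 0` for the `2`-adic residue map `𝓞 K → ℤ/8`, `γ ↦ 4`, `δ ↦ 2`; `φ(x) = 0`; `|N(x)| = 19 · 2^3`.
[cite: Marcus2018, Ch. 5, Thm. 35] -/
theorem span_witness_p19 (hγ : γ ^ 3 - γ ^ 2 + 27 * γ + 36 = 0) (h3 : finrank ℚ K = 3)
    (ψ₁ : 𝓞 K →+* ZMod 2) (h₁ : ψ₁ (thetaInt (aeval_eq hγ)) = 0)
    (φ : 𝓞 K →+* ZMod 19) (hφγ : φ (thetaInt (aeval_eq hγ)) = 15) (hφδ : φ (thetaInt (delta_root hγ)) = 0) :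
    span {((-4 : ℤ) : 𝓞 K) + (-1 : ℤ) * thetaInt (aeval_eq hγ) + (0 : ℤ) * thetaInt (delta_root hγ)} =
      RingHom.ker φ * RingHom.ker ψ₁ ^ 3 := by
  -- finite facts, decided before any local instance is in scope
  have hr : ((4 : ℤ) : ZMod (2 ^ 3)) ^ 3 + ((-1 : ℤ) : ZMod (2 ^ 3)) * ((4 : ℤ) : ZMod (2 ^ 3)) ^ 2 +
      ((27 : ℤ) : ZMod (2 ^ 3)) * (4 : ℤ) + ((36 : ℤ) : ZMod (2 ^ 3)) = 0 := by decide
  have hs : ((3 : ℕ) : ZMod (2 ^ 3)) * 3 = 1 := by decide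
  have hd' : (3 : ZMod (2 ^ 3)) * (((4 : ℤ) : ZMod (2 ^ 3)) ^ 2 - ((4 : ℤ) : ZMod (2 ^ 3)) + 18) = 2 := by
    decide
  have hs3 : (3 : ZMod (2 ^ 3)) * 3 = 1 := by decide
  have hc : ((4 : ℤ) : ZMod (2 ^ 3)) = 4 := by decide
  have hx2 : ((-4 : ℤ) : ZMod (2 ^ 3)) + ((-1 : ℤ) : ZMod (2 ^ 3)) * 4 + ((0 : ℤ) : ZMod (2 ^ 3)) * 2 = 0 := by
    decide
  have hxq : ((-4 : ℤ) : ZMod 19) + ((-1 : ℤ) : ZMod 19) * 15 + ((0 : ℤ) : ZMod 19) * 0 = 0 := by decide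
  have hcast : ZMod.castHom (dvd_pow_self 2 (by omega : (3 : ℕ) ≠ 0)) (ZMod 2) ((4 : ℤ) : ZMod (2 ^ 3)) = 0 := by
    rw [map_intCast]; decide
  haveI : Fact (Nat.Prime 19) := ⟨by norm_num⟩
  obtain ⟨ψ, hψγ, hψδ3⟩ := exists_residueHom_two_pow hγ h3 3 4 hr 3 hs
  have hψδ : ψ (thetaInt (delta_root hγ)) = 2 := by
    have h := congrArg (fun t => (3 : ZMod (2 ^ 3)) * t) hψδ3
    rw [← mul_assoc, hs3, one_mul, hd'] at h
    exact h
  refine span_eq_mul_pow_p2_of hγ h3 (k := 3) (by norm_num) ψ (by rw [hψγ]; exact hcast) ψ₁ h₁ (q := 19)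
    (by norm_num) φ ?_ ?_ ?_
  · simp only [map_add, map_mul, map_intCast, hψγ, hψδ, hc]; exact hx2
  · simp only [map_add, map_mul, map_intCast, hφγ, hφδ]; exact hxq
  · rw [norm_lin3 hγ h3]; norm_num

/-- **`(60 + -7γ + 16δ) = 𝔭 · 𝔭₂^7`** with `𝔭 = ker φ`, `φ : 𝓞 K → ℤ/23`, `(φ(γ), φ(δ)) = (13, 12)`; certificate:
`ψ(x) = 0` for the `2`-adic residue map `𝓞 K → ℤ/128`, `γ ↦ 68`, `δ ↦ 74`; `φ(x) = 0`; `|N(x)| = 23 · 2^7`.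
[cite: Marcus2018, Ch. 5, Thm. 35] -/
theorem span_witness_p23 (hγ : γ ^ 3 - γ ^ 2 + 27 * γ + 36 = 0) (h3 : finrank ℚ K = 3)
    (ψ₁ : 𝓞 K →+* ZMod 2) (h₁ : ψ₁ (thetaInt (aeval_eq hγ)) = 0)
    (φ : 𝓞 K →+* ZMod 23) (hφγ : φ (thetaInt (aeval_eq hγ)) = 13) (hφδ : φ (thetaInt (delta_root hγ)) = 12) :
    span {((60 : ℤ) : 𝓞 K) + (-7 : ℤ) * thetaInt (aeval_eq hγ) + (16 : ℤ) * thetaInt (delta_root hγ)} =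
      RingHom.ker φ * RingHom.ker ψ₁ ^ 7 := by
  -- finite facts, decided before any local instance is in scope
  have hr : ((68 : ℤ) : ZMod (2 ^ 7)) ^ 3 + ((-1 : ℤ) : ZMod (2 ^ 7)) * ((68 : ℤ) : ZMod (2 ^ 7)) ^ 2 +
      ((27 : ℤ) : ZMod (2 ^ 7)) * (68 : ℤ) + ((36 : ℤ) : ZMod (2 ^ 7)) = 0 := by decide
  have hs : ((3 : ℕ) : ZMod (2 ^ 7)) * 43 = 1 := by decide
  have hd' : (43 : ZMod (2 ^ 7)) * (((68 : ℤ) : ZMod (2 ^ 7)) ^ 2 - ((68 : ℤ) : ZMod (2 ^ 7)) + 18) = 74 := by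
    decide
  have hs3 : (43 : ZMod (2 ^ 7)) * 3 = 1 := by decide
  have hc : ((68 : ℤ) : ZMod (2 ^ 7)) = 68 := by decide
  have hx2 : ((60 : ℤ) : ZMod (2 ^ 7)) + ((-7 : ℤ) : ZMod (2 ^ 7)) * 68 + ((16 : ℤ) : ZMod (2 ^ 7)) * 74 = 0 := by
    decide
  have hxq : ((60 : ℤ) : ZMod 23) + ((-7 : ℤ) : ZMod 23) * 13 + ((16 : ℤ) : ZMod 23) * 12 = 0 := by decide
  have hcast : ZMod.castHom (dvd_pow_self 2 (by omega : (7 : ℕ) ≠ 0)) (ZMod 2) ((68 : ℤ) : ZMod (2 ^ 7)) = 0 := by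
    rw [map_intCast]; decide
  haveI : Fact (Nat.Prime 23) := ⟨by norm_num⟩
  obtain ⟨ψ, hψγ, hψδ3⟩ := exists_residueHom_two_pow hγ h3 7 68 hr 43 hs
  have hψδ : ψ (thetaInt (delta_root hγ)) = 74 := by
    have h := congrArg (fun t => (43 : ZMod (2 ^ 7)) * t) hψδ3
    rw [← mul_assoc, hs3, one_mul, hd'] at h
    exact h
  refine span_eq_mul_pow_p2_of hγ h3 (k := 7) (by norm_num) ψ (by rw [hψγ]; exact hcast) ψ₁ h₁ (q := 23)
    (by norm_num) φ ?_ ?_ ?_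
  · simp only [map_add, map_mul, map_intCast, hψγ, hψδ, hc]; exact hx2
  · simp only [map_add, map_mul, map_intCast, hφγ, hφδ]; exact hxq
  · rw [norm_lin3 hγ h3]; norm_num

/-- **`(-18 + 2γ + -5δ) = 𝔭 · 𝔭₂^2`** with `𝔭 = ker φ`, `φ : 𝓞 K → ℤ/29`, `(φ(γ), φ(δ)) = (19, 4)`; certificate:
`ψ(x) = 0` for the `2`-adic residue map `𝓞 K → ℤ/4`, `γ ↦ 0`, `δ ↦ 2`; `φ(x) = 0`; `|N(x)| = 29 · 2^2`.
[cite: Marcus2018, Ch. 5, Thm. 35] -/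
theorem span_witness_p29 (hγ : γ ^ 3 - γ ^ 2 + 27 * γ + 36 = 0) (h3 : finrank ℚ K = 3)
    (ψ₁ : 𝓞 K →+* ZMod 2) (h₁ : ψ₁ (thetaInt (aeval_eq hγ)) = 0)
    (φ : 𝓞 K →+* ZMod 29) (hφγ : φ (thetaInt (aeval_eq hγ)) = 19) (hφδ : φ (thetaInt (delta_root hγ)) = 4) :
    span {((-18 : ℤ) : 𝓞 K) + (2 : ℤ) * thetaInt (aeval_eq hγ) + (-5 : ℤ) * thetaInt (delta_root hγ)} =
      RingHom.ker φ * RingHom.ker ψ₁ ^ 2 := by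
  -- finite facts, decided before any local instance is in scope
  have hr : ((0 : ℤ) : ZMod (2 ^ 2)) ^ 3 + ((-1 : ℤ) : ZMod (2 ^ 2)) * ((0 : ℤ) : ZMod (2 ^ 2)) ^ 2 +
      ((27 : ℤ) : ZMod (2 ^ 2)) * (0 : ℤ) + ((36 : ℤ) : ZMod (2 ^ 2)) = 0 := by decide
  have hs : ((3 : ℕ) : ZMod (2 ^ 2)) * 3 = 1 := by decide
  have hd' : (3 : ZMod (2 ^ 2)) * (((0 : ℤ) : ZMod (2 ^ 2)) ^ 2 - ((0 : ℤ) : ZMod (2 ^ 2)) + 18) = 2 := by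
    decide
  have hs3 : (3 : ZMod (2 ^ 2)) * 3 = 1 := by decide
  have hc : ((0 : ℤ) : ZMod (2 ^ 2)) = 0 := by decide
  have hx2 : ((-18 : ℤ) : ZMod (2 ^ 2)) + ((2 : ℤ) : ZMod (2 ^ 2)) * 0 + ((-5 : ℤ) : ZMod (2 ^ 2)) * 2 = 0 := by
    decide
  have hxq : ((-18 : ℤ) : ZMod 29) + ((2 : ℤ) : ZMod 29) * 19 + ((-5 : ℤ) : ZMod 29) * 4 = 0 := by decide
  have hcast : ZMod.castHom (dvd_pow_self 2 (by omega : (2 : ℕ) ≠ 0)) (ZMod 2) ((0 : ℤ) : ZMod (2 ^ 2)) = 0 := by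
    rw [map_intCast]; decide
  haveI : Fact (Nat.Prime 29) := ⟨by norm_num⟩
  obtain ⟨ψ, hψγ, hψδ3⟩ := exists_residueHom_two_pow hγ h3 2 0 hr 3 hs
  have hψδ : ψ (thetaInt (delta_root hγ)) = 2 := by
    have h := congrArg (fun t => (3 : ZMod (2 ^ 2)) * t) hψδ3
    rw [← mul_assoc, hs3, one_mul, hd'] at h
    exact h
  refine span_eq_mul_pow_p2_of hγ h3 (k := 2) (by norm_num) ψ (by rw [hψγ]; exact hcast) ψ₁ h₁ (q := 29)
    (by norm_num) φ ?_ ?_ ?_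
  · simp only [map_add, map_mul, map_intCast, hψγ, hψδ, hc]; exact hx2
  · simp only [map_add, map_mul, map_intCast, hφγ, hφδ]; exact hxq
  · rw [norm_lin3 hγ h3]; norm_num

/-- **`(-60 + 5γ + -14δ) = 𝔭 · 𝔭₂^2`** with `𝔭 = ker φ`, `φ : 𝓞 K → ℤ/2069`, `(φ(γ), φ(δ)) = (1278, 1930)`; certificate:
`ψ(x) = 0` for the `2`-adic residue map `𝓞 K → ℤ/4`, `γ ↦ 0`, `δ ↦ 2`; `φ(x) = 0`; `|N(x)| = 2069 · 2^2`.
[cite: Marcus2018, Ch. 5, Thm. 35] -/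
theorem span_witness_p2069 (hγ : γ ^ 3 - γ ^ 2 + 27 * γ + 36 = 0) (h3 : finrank ℚ K = 3)
    (ψ₁ : 𝓞 K →+* ZMod 2) (h₁ : ψ₁ (thetaInt (aeval_eq hγ)) = 0)
    (φ : 𝓞 K →+* ZMod 2069) (hφγ : φ (thetaInt (aeval_eq hγ)) = 1278) (hφδ : φ (thetaInt (delta_root hγ)) = 1930) :
    span {((-60 : ℤ) : 𝓞 K) + (5 : ℤ) * thetaInt (aeval_eq hγ) + (-14 : ℤ) * thetaInt (delta_root hγ)} =
      RingHom.ker φ * RingHom.ker ψ₁ ^ 2 := by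
  -- finite facts, decided before any local instance is in scope
  have hr : ((0 : ℤ) : ZMod (2 ^ 2)) ^ 3 + ((-1 : ℤ) : ZMod (2 ^ 2)) * ((0 : ℤ) : ZMod (2 ^ 2)) ^ 2 +
      ((27 : ℤ) : ZMod (2 ^ 2)) * (0 : ℤ) + ((36 : ℤ) : ZMod (2 ^ 2)) = 0 := by decide
  have hs : ((3 : ℕ) : ZMod (2 ^ 2)) * 3 = 1 := by decide
  have hd' : (3 : ZMod (2 ^ 2)) * (((0 : ℤ) : ZMod (2 ^ 2)) ^ 2 - ((0 : ℤ) : ZMod (2 ^ 2)) + 18) = 2 := by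
    decide
  have hs3 : (3 : ZMod (2 ^ 2)) * 3 = 1 := by decide
  have hc : ((0 : ℤ) : ZMod (2 ^ 2)) = 0 := by decide
  have hx2 : ((-60 : ℤ) : ZMod (2 ^ 2)) + ((5 : ℤ) : ZMod (2 ^ 2)) * 0 + ((-14 : ℤ) : ZMod (2 ^ 2)) * 2 = 0 := by
    decide
  have hxq : ((-60 : ℤ) : ZMod 2069) + ((5 : ℤ) : ZMod 2069) * 1278 + ((-14 : ℤ) : ZMod 2069) * 1930 = 0 := by decide
  have hcast : ZMod.castHom (dvd_pow_self 2 (by omega : (2 : ℕ) ≠ 0)) (ZMod 2) ((0 : ℤ) : ZMod (2 ^ 2)) = 0 := by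
    rw [map_intCast]; decide
  haveI : Fact (Nat.Prime 2069) := ⟨by norm_num⟩
  obtain ⟨ψ, hψγ, hψδ3⟩ := exists_residueHom_two_pow hγ h3 2 0 hr 3 hs
  have hψδ : ψ (thetaInt (delta_root hγ)) = 2 := by
    have h := congrArg (fun t => (3 : ZMod (2 ^ 2)) * t) hψδ3
    rw [← mul_assoc, hs3, one_mul, hd'] at h
    exact h
  refine span_eq_mul_pow_p2_of hγ h3 (k := 2) (by norm_num) ψ (by rw [hψγ]; exact hcast) ψ₁ h₁ (q := 2069)
    (by norm_num) φ ?_ ?_ ?_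
  · simp only [map_add, map_mul, map_intCast, hψγ, hψδ, hc]; exact hx2
  · simp only [map_add, map_mul, map_intCast, hφγ, hφδ]; exact hxq
  · rw [norm_lin3 hγ h3]; norm_num

/-- **`(-234 + 40γ + 41δ) = 𝔭 · 𝔭₂^4`** with `𝔭 = ker φ`, `φ : 𝓞 K → ℤ/2069`, `(φ(γ), φ(δ)) = (1583, 278)`; certificate:
`ψ(x) = 0` for the `2`-adic residue map `𝓞 K → ℤ/16`, `γ ↦ 4`, `δ ↦ 10`; `φ(x) = 0`; `|N(x)| = 2069 · 2^4`.
[cite: Marcus2018, Ch. 5, Thm. 35] -/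
theorem span_witness_q2069 (hγ : γ ^ 3 - γ ^ 2 + 27 * γ + 36 = 0) (h3 : finrank ℚ K = 3)
    (ψ₁ : 𝓞 K →+* ZMod 2) (h₁ : ψ₁ (thetaInt (aeval_eq hγ)) = 0)
    (φ : 𝓞 K →+* ZMod 2069) (hφγ : φ (thetaInt (aeval_eq hγ)) = 1583) (hφδ : φ (thetaInt (delta_root hγ)) = 278) :
    span {((-234 : ℤ) : 𝓞 K) + (40 : ℤ) * thetaInt (aeval_eq hγ) + (41 : ℤ) * thetaInt (delta_root hγ)} =
      RingHom.ker φ * RingHom.ker ψ₁ ^ 4 := by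
  -- finite facts, decided before any local instance is in scope
  have hr : ((4 : ℤ) : ZMod (2 ^ 4)) ^ 3 + ((-1 : ℤ) : ZMod (2 ^ 4)) * ((4 : ℤ) : ZMod (2 ^ 4)) ^ 2 +
      ((27 : ℤ) : ZMod (2 ^ 4)) * (4 : ℤ) + ((36 : ℤ) : ZMod (2 ^ 4)) = 0 := by decide
  have hs : ((3 : ℕ) : ZMod (2 ^ 4)) * 11 = 1 := by decide
  have hd' : (11 : ZMod (2 ^ 4)) * (((4 : ℤ) : ZMod (2 ^ 4)) ^ 2 - ((4 : ℤ) : ZMod (2 ^ 4)) + 18) = 10 := by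
    decide
  have hs3 : (11 : ZMod (2 ^ 4)) * 3 = 1 := by decide
  have hc : ((4 : ℤ) : ZMod (2 ^ 4)) = 4 := by decide
  have hx2 : ((-234 : ℤ) : ZMod (2 ^ 4)) + ((40 : ℤ) : ZMod (2 ^ 4)) * 4 + ((41 : ℤ) : ZMod (2 ^ 4)) * 10 = 0 := by
    decide
  have hxq : ((-234 : ℤ) : ZMod 2069) + ((40 : ℤ) : ZMod 2069) * 1583 + ((41 : ℤ) : ZMod 2069) * 278 = 0 := by decide
  have hcast : ZMod.castHom (dvd_pow_self 2 (by omega : (4 : ℕ) ≠ 0)) (ZMod 2) ((4 : ℤ) : ZMod (2 ^ 4)) = 0 := by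
    rw [map_intCast]; decide
  haveI : Fact (Nat.Prime 2069) := ⟨by norm_num⟩
  obtain ⟨ψ, hψγ, hψδ3⟩ := exists_residueHom_two_pow hγ h3 4 4 hr 11 hs
  have hψδ : ψ (thetaInt (delta_root hγ)) = 10 := by
    have h := congrArg (fun t => (11 : ZMod (2 ^ 4)) * t) hψδ3
    rw [← mul_assoc, hs3, one_mul, hd'] at h
    exact h
  refine span_eq_mul_pow_p2_of hγ h3 (k := 4) (by norm_num) ψ (by rw [hψγ]; exact hcast) ψ₁ h₁ (q := 2069)
    (by norm_num) φ ?_ ?_ ?_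
  · simp only [map_add, map_mul, map_intCast, hψγ, hψδ, hc]; exact hx2
  · simp only [map_add, map_mul, map_intCast, hφγ, hφδ]; exact hxq
  · rw [norm_lin3 hγ h3]; norm_num

/-- **`(-1 - γ) = 𝔮₇`**, `𝔮₇ = ker φ`, `φ : 𝓞 K → ℤ/7`, `φ(γ) = 6`: the prime `(7, γ - 6)` is principal (`|N(-1-γ)| = 7`).
[cite: Marcus2018, Ch. 5, Thm. 35] -/
theorem span_witness_q7 (hγ : γ ^ 3 - γ ^ 2 + 27 * γ + 36 = 0) (h3 : finrank ℚ K = 3)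
    (φ : 𝓞 K →+* ZMod 7) (hφγ : φ (thetaInt (aeval_eq hγ)) = 6) :
    span {((-1 : ℤ) : 𝓞 K) + (-1 : ℤ) * thetaInt (aeval_eq hγ) + (0 : ℤ) * thetaInt (delta_root hγ)} = RingHom.ker φ := by
  have hxq : ((-1 : ℤ) : ZMod 7) + ((-1 : ℤ) : ZMod 7) * 6 + ((0 : ℤ) : ZMod 7) * φ (thetaInt (delta_root hγ)) = 0 := by
    have : ((0 : ℤ) : ZMod 7) = 0 := by decide
    rw [this, zero_mul, add_zero]; decide
  haveI : Fact (Nat.Prime 7) := ⟨by norm_num⟩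
  refine span_singleton_eq_of_mem_of_absNorm ?_ ?_ ?_
  · rw [RingHom.mem_ker]; simp only [map_add, map_mul, map_intCast, hφγ]; exact hxq
  · rw [norm_lin3 hγ h3, absNorm_ker_zmod]; norm_num
  · intro h0
    have h := congrArg (Algebra.norm ℤ) h0
    rw [norm_lin3 hγ h3, Algebra.norm_zero] at h
    norm_num at h

/-- **`(6 + γ - δ) = 𝔭₂⁸`** (`π₀ = 6 + γ - δ`, `N(π₀) = -256`): the eighth power of `𝔭₂ = (2, γ)` is principal. Certificate:
`ψ(π₀) = 0` for the `2`-adic residue map `𝓞 K → ℤ/256`, `γ ↦ 196`, `δ ↦ 202`. [cite: Marcus2018, Ch. 5, Thm. 35] -/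
theorem span_pi0_eq_p2_pow_eight (hγ : γ ^ 3 - γ ^ 2 + 27 * γ + 36 = 0) (h3 : finrank ℚ K = 3)
    (ψ₁ : 𝓞 K →+* ZMod 2) (h₁ : ψ₁ (thetaInt (aeval_eq hγ)) = 0) :
    span {((6 : ℤ) : 𝓞 K) + (1 : ℤ) * thetaInt (aeval_eq hγ) + (-1 : ℤ) * thetaInt (delta_root hγ)} =
      RingHom.ker ψ₁ ^ 8 := by
  have hr : ((196 : ℤ) : ZMod (2 ^ 8)) ^ 3 + ((-1 : ℤ) : ZMod (2 ^ 8)) * ((196 : ℤ) : ZMod (2 ^ 8)) ^ 2 +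
      ((27 : ℤ) : ZMod (2 ^ 8)) * (196 : ℤ) + ((36 : ℤ) : ZMod (2 ^ 8)) = 0 := by decide
  have hs : ((3 : ℕ) : ZMod (2 ^ 8)) * 171 = 1 := by decide
  have hd' : (171 : ZMod (2 ^ 8)) * (((196 : ℤ) : ZMod (2 ^ 8)) ^ 2 - ((196 : ℤ) : ZMod (2 ^ 8)) + 18) = 202 := by
    decide
  have hs3 : (171 : ZMod (2 ^ 8)) * 3 = 1 := by decide
  have hc : ((196 : ℤ) : ZMod (2 ^ 8)) = 196 := by decide
  have hx2 : ((6 : ℤ) : ZMod (2 ^ 8)) + ((1 : ℤ) : ZMod (2 ^ 8)) * 196 + ((-1 : ℤ) : ZMod (2 ^ 8)) * 202 = 0 := by decide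
  have hcast : ZMod.castHom (dvd_pow_self 2 (by omega : (8 : ℕ) ≠ 0)) (ZMod 2) ((196 : ℤ) : ZMod (2 ^ 8)) = 0 := by
    rw [map_intCast]; decide
  haveI : Fact (Nat.Prime 2) := ⟨Nat.prime_two⟩
  obtain ⟨ψ, hψγ, hψδ3⟩ := exists_residueHom_two_pow hγ h3 8 196 hr 171 hs
  have hψδ : ψ (thetaInt (delta_root hγ)) = 202 := by
    have h := congrArg (fun t => (171 : ZMod (2 ^ 8)) * t) hψδ3
    rw [← mul_assoc, hs3, one_mul, hd'] at h
    exact h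
  have hker := ker_eq_pow_p2 hγ h3 (k := 8) (by norm_num) ψ (by rw [hψγ]; exact hcast) ψ₁ h₁
  rw [← hker]
  refine span_singleton_eq_of_mem_of_absNorm ?_ ?_ ?_
  · rw [RingHom.mem_ker]; simp only [map_add, map_mul, map_intCast, hψγ, hψδ, hc]; exact hx2
  · rw [norm_lin3 hγ h3, absNorm_ker_zmodPow]; norm_num
  · intro h0
    have h := congrArg (Algebra.norm ℤ) h0
    rw [norm_lin3 hγ h3, Algebra.norm_zero] at h
    norm_num at h

end CubicField14483

end Literature.NumberTheory.NumberFields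

end
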